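import Literature.Computability.Complexity.BFNWTable
import Literature.Computability.Complexity.BFNWFooling
import Literature.Computability.Complexity.UniformDerandomizationAssembly
import Literature.Computability.Complexity.IKWSimulationMachine
import HarnessLib

/-!
# IW98, Case 1 (BFNW): the i.o. generator as a `2^{O(m^p)} · poly(n)`-time machine and its matrix
# clause (`IWUniform.IOPRGAt`, third conjunct)

Literature / complexity — derandomization. Machine step of hypothesis `h₁` (Case 1 of
Impagliazzo–Wigderson 1998 = Babai–Fortnow–Nisan–Wigderson 1993) of
`impagliazzoWigderson1998_of_generators` (`UniformDerandomizationAssembly.lean`). The generator is the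
table generator of IKW's Theorem 11 (`IKW2002_thm11_tableGenerator`; string form `IWUniform.tableGen`,
`BFNWFooling.lean`) armed with the truth table of the slice `f₀ ∩ {0,1}^m` of a language `f₀ ∈ EXP`
at the scale `m = Nat.sqrt^[j] n` of the instance length `n`:

  `g n σ = tableGen F (f₀.sliceFn m) (Nb n) (q n) σ = (F ⟨tt(f₀ ∩ {0,1}^m), ⟨1^{Nb n}, σ⟩⟩) ↾ᴰ q(n)`.

* `IWUniform.fpProducer_iterate_sqrt`, `IWUniform.fpProducer_seed` — the scale `0^{m}` and the seed
  range `0^{c m^{sx}}` are `FP`-producible (`IKWSim.scaleF`, `IKWSim.kF`);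
* `IWUniform.genPostF` (+ `_mem_FP`, `_apply`) — the polynomial-time post-processing
  `⟨tt, ⟨x, σ⟩⟩ ↦ ⟨x, (F ⟨tt, ⟨1^{Nb |x|}, σ⟩⟩) ↾ᴰ q |x|⟩`;
* **`IWUniform.exists_tableGen_machine`** — a machine mapping every word `w = ⟨x, σ⟩` to
  `⟨x, g_{|x|}(σ)⟩` within `tG |x| |w|` steps, `tG n (2n + 2 + k n)` an `NKannan.EBnd p j` quantity
  (`2^{O(m^p)} · poly(n)`) as soon as `p ≥ 1` dominates the time exponent of `f₀` and the seed
  length: duplicate `x` (`FP`), write the truth table on the first copy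
  (`NKannan.exists_truthTable_machine` under `mapFstAux`, `2^{O(m)} · poly(n) · 2^{q₀(m)}` steps), post-process (`FP`
  in the length `2^{m+1} + O(n + k n)` of its input);
* **`IWUniform.matrix_clause_tableGen`** — hence, for every `L' ∈ P`, the matrix
  `{⟨x, σ⟩ | ⟨x, g_{|x|}(σ)⟩ ∈ L'}` is decided within an `EBnd p j` time one level up
  (`matrix_clause_of_machine`), the matrix clause of `IWUniform.IOPRGAt`.

Everything is proved; the only definition is the `FP` brick `genPostF`.

## References

* [ImpagliazzoWigderson2001] R. Impagliazzo, A. Wigderson, JCSS 63 (2001), §2.1, first paragraph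
  (Case `EXP ⊄ P/poly`: [BFNW93]).
* L. Babai, L. Fortnow, N. Nisan, A. Wigderson, Comput. Complexity 3 (1993) 307–318, §4 (the
  generator run on the truth table of an `EXP` function at input length `n^{ε}`; cited through IW).
* [AroraBarakCC2009] CUP 2009, proof of Lemma 20.3 and of Thm. 20.6 (time `2^{O(m)}` for the table,
  then the generator), §1.3 (composition of machines).
* [ImpagliazzoKabanetsWigderson2002] JCSS 65 (2002), Thm. 11 (`F ∈ FP`).
-/

noncomputable section

namespace Literature.Computability.Complexity

namespace IWUniform

open _root_.Computability Turing Function Polynomial Brick Plumb MetaComplexity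

/-! ### Producers of the scale and of the seed range -/

/-- The scale `0^{m(|x|)}`, `m = Nat.sqrt^[j]`, is `FP`-producible (`IKWSim.scaleF`). [folklore] -/
theorem fpProducer_iterate_sqrt (j : ℕ) : NKannan.FPProducer (Nat.sqrt^[j]) :=
  ⟨Kannan.zerosFn ∘ IKWSim.scaleF j, comp_mem_FP Kannan.zerosFn_mem_FP (IKWSim.scaleF_mem_FP j),
    fun x => by simp [ones]⟩

/-- The seed range `0^{c m(|x|)^{sx}}` is `FP`-producible (`IKWSim.kF`). [folklore] -/
theorem fpProducer_seed (c sx j : ℕ) : NKannan.FPProducer fun n => c * (Nat.sqrt^[j] n) ^ sx :=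
  ⟨Kannan.zerosFn ∘ IKWSim.kF c sx j, comp_mem_FP Kannan.zerosFn_mem_FP (IKWSim.kF_mem_FP c sx j),
    fun x => by simp [IKWSim.kF, onesMulFn, ones]⟩

/-! ### The post-processing brick -/

/-- **The post-processing** `⟨tt, ⟨x, σ⟩⟩ ↦ ⟨x, (F ⟨tt, ⟨1^{Nb |x|}, σ⟩⟩) ↾ᴰ q |x|⟩`: re-pair the
instance with the first `q(|x|)` output bits of `F` run on the table, the output length in unary and
the seed. [cite: ImpagliazzoKabanetsWigderson2002, Thm. 11 (the generator `F(r, s)`)] -/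
def genPostF (F : List Bool → List Bool) (Nb q : Polynomial ℕ) : List Bool → List Bool :=
  fanoutFn (fstF ∘ sndF)
    (fstF ∘ padTakeFn ∘ fanoutFn (polyFn q ∘ fstF ∘ sndF)
      (F ∘ fanoutFn fstF (fanoutFn (polyFn Nb ∘ fstF ∘ sndF) (sndF ∘ sndF))))

/-- `genPostF F Nb q ∈ FP` for `F ∈ FP`. [folklore] -/
theorem genPostF_mem_FP {F : List Bool → List Bool} (hF : F ∈ FP) (Nb q : Polynomial ℕ) :
    genPostF F Nb q ∈ FP :=
  fanoutFn_mem_FP (comp_mem_FP fstF_mem_FP sndF_mem_FP)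
    (comp_mem_FP fstF_mem_FP (comp_mem_FP padTakeFn_mem_FP (fanoutFn_mem_FP
      (comp_mem_FP (polyFn_mem_FP q) (comp_mem_FP fstF_mem_FP sndF_mem_FP))
      (comp_mem_FP hF (fanoutFn_mem_FP fstF_mem_FP (fanoutFn_mem_FP
        (comp_mem_FP (polyFn_mem_FP Nb) (comp_mem_FP fstF_mem_FP sndF_mem_FP))
        (comp_mem_FP sndF_mem_FP sndF_mem_FP)))))))

/-- **Value of the post-processing** on `⟨tt f, w⟩`: `⟨fstF w, tableGen F f (Nb |fstF w|) (q |fstF w|) (sndF w)⟩`.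
[folklore] -/
theorem genPostF_apply' (F : List Bool → List Bool) (Nb q : Polynomial ℕ) {M : ℕ}
    (f : (Fin M → Bool) → Bool) (w : List Bool) :
    genPostF F Nb q (boolPair (truthTable f) w) =
      boolPair (fstF w) (tableGen F f (Nb.eval (fstF w).length) (q.eval (fstF w).length) (sndF w)) := by
  simp only [genPostF, comp_apply, fanoutFn_apply, fstF_boolPair, sndF_boolPair, polyFn_apply,
    padTakeFn_boolPair, tableGen, OracleCompose.unaryEncodeNat_eq_replicate, ones,
    List.length_replicate]

/-- **Value of the post-processing** on `⟨tt f, ⟨x, σ⟩⟩`: `⟨x, tableGen F f (Nb |x|) (q |x|) σ⟩`.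
[folklore] -/
theorem genPostF_apply (F : List Bool → List Bool) (Nb q : Polynomial ℕ) {M : ℕ}
    (f : (Fin M → Bool) → Bool) (x σ : List Bool) :
    genPostF F Nb q (boolPair (truthTable f) (boolPair x σ)) =
      boolPair x (tableGen F f (Nb.eval x.length) (q.eval x.length) σ) := by
  rw [genPostF_apply', fstF_boolPair, sndF_boolPair]

/-! ### The generator machine -/

/-- **The i.o. generator as a machine.** For `F ∈ FP`, `f₀` decided within `2^{q₀(n)}` steps,
`q₀(m) ≤ K₀ m^p + K₀`, `p ≥ 1`, and a seed length `k n ≤ K m^p + K` (`m = Nat.sqrt^[j] n`), some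
machine maps every word `w` to `⟨fstP w, g_{|fstP w|}(sndP w)⟩`,
`g n σ = tableGen F (f₀.sliceFn m) (Nb n) (q n) σ`, within `tG |fstP w| |w|` steps, where
`n ↦ tG n (2n + 2 + k n)` is an `EBnd p j` quantity: duplicate the instance, write the truth table of
`f₀ ∩ {0,1}^m` on the first copy (`exists_truthTable_machine` under `mapFstAux`), post-process in `FP`.
[cite: AroraBarakCC2009, Thm. 20.6 (proof) and Lemma 20.3 (proof)]
[cite: ImpagliazzoWigderson2001, §2.1, first paragraph] -/
theorem exists_tableGen_machine {F : List Bool → List Bool} (hF : F ∈ FP) {f₀ : Language Bool}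
    {q₀ : Polynomial ℕ} (hf₀ : TimeDecidable (id : List Bool → List Bool) f₀ fun n => 2 ^ q₀.eval n)
    {p j K₀ : ℕ} (hp : 1 ≤ p) (hq₀ : ∀ m, q₀.eval m ≤ K₀ * m ^ p + K₀) (Nb q : Polynomial ℕ)
    {k : ℕ → ℕ} (hkK : ∃ K, ∀ n, k n ≤ K * (Nat.sqrt^[j] n) ^ p + K) :
    ∃ (MG : TM2ComputableAux Bool Bool) (tG : ℕ → ℕ → ℕ),
      (∀ w : List Bool, MG.OutputsWithin w
        (boolPair (fstP w) (tableGen F (f₀.sliceFn (Nat.sqrt^[j] (fstP w).length))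
          (Nb.eval (fstP w).length) (q.eval (fstP w).length) (sndP w)))
        (tG (fstP w).length w.length)) ∧
      NKannan.EBnd p j fun n => tG n (2 * n + 2 + k n) := by
  classical
  obtain ⟨a, c, d, pT, MT, hMT⟩ := NKannan.exists_truthTable_machine (fpProducer_iterate_sqrt j) hf₀
  obtain ⟨p₁, M1, hM1⟩ := NKannan.exists_outputsWithin_of_mem_FP
    (fanoutFn_mem_FP fstF_mem_FP (PolyTimeComputable.id _))
  obtain ⟨p₂, M2, hM2⟩ := NKannan.exists_outputsWithin_of_mem_FP (genPostF_mem_FP hF Nb q)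
  -- the time, as a function of the instance length `n` and the word length `N`: duplication,
  -- table (+ the `mapFstAux` overhead), post-processing
  refine ⟨(M1.comp (mapFstAux MT)).comp M2, fun n N =>
    p₂.eval (2 * 2 ^ (Nat.sqrt^[j] n) + 2 + N) +
      ((NKannan.fineCost a pT (Nat.sqrt^[j]) (fun n N' => c * N' ^ d + c + 2 ^ q₀.eval (Nat.sqrt^[j] n)) n n +
        3 * 2 ^ (Nat.sqrt^[j] n) + 2 * (2 * n + 2 + N) + 6) +
      p₁.eval N), fun w => ?_, ?_⟩
  · have eF : fstF w = fstP w := rfl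
    have eS : sndF w = sndP w := rfl
    -- 1. duplicate the instance
    have h1 := hM1 w
    simp only [fanoutFn_apply, eF] at h1
    -- 2. the truth table on the first copy
    have h2 := outputsWithin_mapFstAux MT (z := boolPair (fstP w) w)
      (out := truthTable (f₀.sliceFn (Nat.sqrt^[j] (fstP w).length)))
      (by rw [boolUnpair_boolPair]; exact hMT (fstP w))
    rw [readRest_boolPair, length_truthTable, length_boolPair] at h2
    -- 3. post-processing
    have h3 := hM2 (boolPair (truthTable (f₀.sliceFn (Nat.sqrt^[j] (fstP w).length))) w)
    rw [genPostF_apply', eF, eS, length_boolPair, length_truthTable] at h3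
    exact TM2ComputableAux.comp_outputsWithin _ _ (TM2ComputableAux.comp_outputsWithin _ _ h1 h2) h3
  · -- the budget
    obtain ⟨K, hK⟩ := hkK
    have hp0 : p ≠ 0 := by omega
    have hmp : ∀ n, Nat.sqrt^[j] n ≤ (Nat.sqrt^[j] n) ^ p := fun n => Nat.le_self_pow hp0 _
    have bm : NKannan.EBnd p j (Nat.sqrt^[j]) := NKannan.EBnd.lin 1 fun n => by
      have := hmp n; omega
    have bN : NKannan.EBnd p j fun n => 2 * n + 2 + k n :=
      (((NKannan.EBnd.const 2).mul NKannan.EBnd.self).add (NKannan.EBnd.const 2)).add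
        (NKannan.EBnd.lin K hK)
    have b2m : NKannan.EBnd p j fun n => 2 ^ (Nat.sqrt^[j] n) := NKannan.EBnd.two_pow 1 fun n => by
      have := hmp n; omega
    have bt₀ : NKannan.EBnd p j fun n =>
        c * (2 * n + 2 + Nat.sqrt^[j] n) ^ d + c + 2 ^ q₀.eval (Nat.sqrt^[j] n) := by
      have bin : NKannan.EBnd p j fun n => 2 * n + 2 + Nat.sqrt^[j] n :=
        (((NKannan.EBnd.const 2).mul NKannan.EBnd.self).add (NKannan.EBnd.const 2)).add bm
      exact (((NKannan.EBnd.const c).mul (bin.pow d)).add (NKannan.EBnd.const c)).add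
        (NKannan.EBnd.two_pow K₀ fun n => hq₀ _)
    have btT : NKannan.EBnd p j fun n => NKannan.fineCost a pT (Nat.sqrt^[j])
        (fun n N' => c * N' ^ d + c + 2 ^ q₀.eval (Nat.sqrt^[j] n)) n n := by
      have b1 : NKannan.EBnd p j fun n => 2 ^ (a * (Nat.sqrt^[j] n + 1)) :=
        NKannan.EBnd.two_pow a fun n => by have := hmp n; nlinarith
      exact (b1.mul (NKannan.EBnd.poly pT NKannan.EBnd.self)).mul (bt₀.add (NKannan.EBnd.const 1))
    exact (NKannan.EBnd.poly p₂ ((((NKannan.EBnd.const 2).mul b2m).add (NKannan.EBnd.const 2)).add bN)).add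
      ((((btT.add ((NKannan.EBnd.const 3).mul b2m)).add
        ((NKannan.EBnd.const 2).mul ((((NKannan.EBnd.const 2).mul NKannan.EBnd.self).add
          (NKannan.EBnd.const 2)).add bN))).add (NKannan.EBnd.const 6)).add (NKannan.EBnd.poly p₁ bN))

/-! ### The matrix clause -/

/-- **The matrix clause of `IOPRGAt` for the table generator**: under the hypotheses of
`exists_tableGen_machine`, for every `L' ∈ P` the matrix `{⟨x, σ⟩ | ⟨x, g_{|x|}(σ)⟩ ∈ L'}` of
`g n = tableGen F (f₀.sliceFn m) (Nb n) (q n)` is decided one level up within an `EBnd p j` time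
(`matrix_clause_of_machine`). [cite: ImpagliazzoWigderson2001, §2.1] [cite: AroraBarakCC2009, Lemma 20.3 (proof)] -/
theorem matrix_clause_tableGen {F : List Bool → List Bool} (hF : F ∈ FP) {f₀ : Language Bool}
    {q₀ : Polynomial ℕ} (hf₀ : TimeDecidable (id : List Bool → List Bool) f₀ fun n => 2 ^ q₀.eval n)
    {p j K₀ : ℕ} (hp : 1 ≤ p) (hq₀ : ∀ m, q₀.eval m ≤ K₀ * m ^ p + K₀) (Nb q : Polynomial ℕ)
    {k : ℕ → ℕ} (hkK : ∃ K, ∀ n, k n ≤ K * (Nat.sqrt^[j] n) ^ p + K) {L' : Language Bool}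
    (hL' : L' ∈ Classes.P) :
    ∃ t : ℕ → ℕ → ℕ,
      NKannan.DecIn 1 (matrix L' fun n => tableGen F (f₀.sliceFn (Nat.sqrt^[j] n)) (Nb.eval n) (q.eval n)) t ∧
      NKannan.EBnd p j fun n => t n (2 * n + 2 + k n) := by
  obtain ⟨MG, tG, hMG, htG⟩ := exists_tableGen_machine hF hf₀ hp hq₀ Nb q hkK
  exact matrix_clause_of_machine ⟨MG, hMG⟩ hkK htG hL'

end IWUniform

end Literature.Computability.Complexity

end
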